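import Mathlib
import Summits.Ventures.HodgeRepro.Tier4.Common.AdelicDefs
import Summits.Ventures.HodgeRepro.Tier4.Common.AdelicPlaces
import Summits.Ventures.HodgeRepro.Tier4.Common.AdelicHaar
import Summits.Ventures.HodgeRepro.Tier4.Common.CompactOpenLevel
import Summits.Ventures.HodgeRepro.Tier4.Common.MixedPlaneKType
import Summits.Ventures.HodgeRepro.Tier4.Common.LocalTorus
import Summits.Ventures.HodgeRepro.Tier4.Common.RowPlane
import Summits.Ventures.HodgeRepro.Tier4.Common.RowTorus
import Summits.Ventures.HodgeRepro.Tier4.Common.RowWeights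
import Summits.Ventures.HodgeRepro.Tier4.Line1.RationalPoints
import Summits.Ventures.HodgeRepro.Tier4.Line1.TotallyDefiniteCompact

/-!
# Tier4/Common/LocalTorusCompact — the LOCAL TORUS `T(k_w)` of a row plane at a real CM place is COMPACT

Blind re-derivation cell `pub-hodge-repro`, Tier 4 «prove the step» (README §9–§10), seat t4-typer-2 (gen 3).
Target tree path `lean/Summits/Ventures/HodgeRepro/Tier4/Common/LocalTorusCompact.lean`.  Mathlib + Common
(`CompactOpenLevel`: the closed embedding `g ↦ (g, g⁻¹)`, `infPart` / `finPart`; `RowTorus`: the block description of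
the torus of a row plane; `RowWeights`: `IsCMAt`, `tAt`, `nAt`) + `Line1.TotallyDefiniteCompact` (`realEntry`, the
`w`-component in `ℝ` at a real place, t4-L1-p2 g4) + `Line1.RationalPoints` (`t2Space_finiteAdeleRing`); no literature.

WHY (t4-L4-p1 S14029 (α), t4-L4-p2 S13981, crit-1's C3 watch): the `(C, χ)`-projector (KTypeProjector …) and the
`K`-type cuts of LINE L4 take `[CompactSpace (localTorusAt W w)]` + a Haar probability on it as DISPLAYED inputs.  Here
it is PROVED for the row planes `ofLinesRow q a b ε` at a real CM place `w`: an element of `localTorusAt W w` is a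
torus element supported at `w`, i.e. (RowTorus) `blockDiag4R (x₀•1 + y₀•ω) (x₁•1 + y₁•ω)` with the norm-one
conditions `x_j² + t x_j y_j + n y_j² = 1`, and with EVERY component at a place `≠ w` equal to the identity; at `w` the
norm-one condition is the ELLIPSE `x² + t_w x y + n_w y² = 1` (positive definite: `IsCMAt q w`, `t_w² < 4 n_w`), so
the `w`-entries are bounded by an explicit `C`; the local torus is a closed subset of the preimage, under the closed
embedding `g ↦ (g, g⁻¹)` of `CompactOpenLevel`, of a compact box (identity away from `w`, `[−C, C]` at `w`).

* `abs_le_of_normOne_real` — the ellipse bound `x² + t x y + n y² = 1`, `t² < 4 n` ⇒ `|x| ≤ √(4n/(4n − t²))`,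
  `|y| ≤ √(4/(4n − t²))`; `realEntry_t`, `realEntry_n` — `t_w`, `n_w` in `ℝ` through `realEntry`;
* `blockBound q w`, `abs_realEntry_blockOf_le`, `abs_realEntry_blockDiag4R_le` — the entry bound of a norm-one block;
* `isClosed_atPlace`, `isClosed_localTorusAt`, `isClosed_localTorusAt'` — closedness (AdelicHaar's `isClosed_torusT` /
  `isClosed_torusT'`; the components at the other places are the identity: preimages of points in Hausdorff spaces);
* `entryBoxAt`, `isCompact_entryBoxAt`, `mem_entryBoxAt`, `torusBox`, `isCompact_torusBox`,
  `mem_torusBox_of_mem_localTorusAt` — the compact box and the membership of the torus elements;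
* **`isCompact_localTorusAt_ofLinesRow`** — `IsCompact (localTorusAt (ofLinesRow q a b ε) w : Set (GA _))` at a real
  CM place; **`compactSpace_localTorusAt_ofLinesRow`** — the typeclass form the projector consumes.

NOT here: the `T′`-side `localTorusAt' (seesawPlane …) w` (conjugate into this torus by `Line4.ProjPlane`; on request).

Nothing here says anything about the status of the Hodge conjecture for CM abelian varieties, which is NOT proved
(HC_CM is NOT proved by anyone in this repository).
-/

set_option autoImplicit false

noncomputable section

namespace Summit.Ventures.HodgeRepro.Tier4.Common

open NumberField IsDedekindDomain Matrix Set Topology Summit.Ventures.HodgeRepro.Tier4.Line1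

section Ellipse

/-- **The norm-one ellipse is bounded**: `x² + t x y + n y² = 1` with `t² < 4 n` gives explicit bounds on `|x|`, `|y|`. -/
theorem abs_le_of_normOne_real {t n x y : ℝ} (hD : t ^ 2 < 4 * n) (h : x ^ 2 + t * x * y + n * y ^ 2 = 1) :
    |x| ≤ Real.sqrt (4 * n / (4 * n - t ^ 2)) ∧ |y| ≤ Real.sqrt (4 / (4 * n - t ^ 2)) := by
  have hpos : 0 < 4 * n - t ^ 2 := by linarith
  have hy2 : (4 * n - t ^ 2) * y ^ 2 ≤ 4 := by nlinarith [sq_nonneg (2 * x + t * y)]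
  have hx2 : (4 * n - t ^ 2) * x ^ 2 ≤ 4 * n := by nlinarith [sq_nonneg (2 * n * y + t * x)]
  constructor
  · apply Real.abs_le_sqrt
    rw [le_div_iff₀ hpos, mul_comm]
    exact hx2
  · apply Real.abs_le_sqrt
    rw [le_div_iff₀ hpos, mul_comm]
    exact hy2

end Ellipse

section RealPlace

variable {k : Type} [Field k] [NumberField k] (q : QuadData k) {w : InfinitePlace k} (hw : w.IsReal)

/-- `t_w` in `ℝ` through the real entry map. -/
theorem realEntry_t : realEntry hw (algebraMap k (Ad k) q.t) = (tAt q w).re := by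
  show InfinitePlace.Completion.extensionEmbeddingOfIsReal hw (adComponentInf k w (algebraMap k (Ad k) q.t)) = _
  rw [← Complex.ofReal_re (InfinitePlace.Completion.extensionEmbeddingOfIsReal hw _),
    InfinitePlace.Completion.extensionEmbeddingOfIsReal_apply]
  rfl

/-- `n_w` in `ℝ` through the real entry map. -/
theorem realEntry_n : realEntry hw (algebraMap k (Ad k) q.n) = (nAt q w).re := by
  show InfinitePlace.Completion.extensionEmbeddingOfIsReal hw (adComponentInf k w (algebraMap k (Ad k) q.n)) = _
  rw [← Complex.ofReal_re (InfinitePlace.Completion.extensionEmbeddingOfIsReal hw _),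
    InfinitePlace.Completion.extensionEmbeddingOfIsReal_apply]
  rfl

/-- The entry bound of a norm-one block at `w`: the ellipse bounds times `1 + |t_w| + |n_w|`. -/
def blockBound (w : InfinitePlace k) : ℝ :=
  (Real.sqrt (4 * (nAt q w).re / (4 * (nAt q w).re - (tAt q w).re ^ 2)) +
      Real.sqrt (4 / (4 * (nAt q w).re - (tAt q w).re ^ 2))) * (1 + |(tAt q w).re| + |(nAt q w).re|)

omit [NumberField k] in
/-- The block bound is non-negative. -/
theorem blockBound_nonneg (w : InfinitePlace k) : 0 ≤ blockBound q w := by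
  unfold blockBound
  positivity

/-- The `(0,1)` entry of `x • 1 + y • ω` is `−n y`. -/
theorem blockOf_apply_zero_one {R : Type} [CommRing R] (t n x y : R) : blockOf t n x y 0 1 = -n * y := by
  simp [blockOf, omegaMatR]
  ring

/-- The `(1,1)` entry of `x • 1 + y • ω` is `x + t y`. -/
theorem blockOf_apply_one_one {R : Type} [CommRing R] (t n x y : R) : blockOf t n x y 1 1 = x + t * y := by
  simp [blockOf, omegaMatR]
  ring

/-- **The entries of a norm-one block are bounded at a real CM place.** -/
theorem abs_realEntry_blockOf_le (hcm : IsCMAt q w) (x y : Ad k)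
    (hN : x ^ 2 + algebraMap k (Ad k) q.t * x * y + algebraMap k (Ad k) q.n * y ^ 2 = 1) (i j : Fin 2) :
    |realEntry hw (blockOf (algebraMap k (Ad k) q.t) (algebraMap k (Ad k) q.n) x y i j)| ≤ blockBound q w := by
  set tr := (tAt q w).re with htr
  set nr := (nAt q w).re with hnr
  have hNr : (realEntry hw x) ^ 2 + tr * realEntry hw x * realEntry hw y + nr * (realEntry hw y) ^ 2 = 1 := by
    have h := congrArg (realEntry hw) hN
    simp only [map_add, map_mul, map_pow, map_one, realEntry_t, realEntry_n] at h
    exact h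
  have hD : tr ^ 2 < 4 * nr := hcm
  obtain ⟨hx, hy⟩ := abs_le_of_normOne_real hD hNr
  set c := Real.sqrt (4 * nr / (4 * nr - tr ^ 2)) + Real.sqrt (4 / (4 * nr - tr ^ 2)) with hc
  have hxc : |realEntry hw x| ≤ c := hx.trans (by rw [hc]; linarith [Real.sqrt_nonneg (4 / (4 * nr - tr ^ 2))])
  have hyc : |realEntry hw y| ≤ c := hy.trans (by rw [hc]; linarith [Real.sqrt_nonneg (4 * nr / (4 * nr - tr ^ 2))])
  have hc0 : 0 ≤ c := (abs_nonneg _).trans hxc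
  have hB : blockBound q w = c * (1 + |tr| + |nr|) := rfl
  rw [hB]
  have h1 : c ≤ c * (1 + |tr| + |nr|) := by nlinarith [abs_nonneg tr, abs_nonneg nr]
  have key : ∀ i j : Fin 2, blockOf (algebraMap k (Ad k) q.t) (algebraMap k (Ad k) q.n) x y i j =
      !![x, -(algebraMap k (Ad k) q.n) * y; y, x + algebraMap k (Ad k) q.t * y] i j := by
    intro i j
    fin_cases i <;> fin_cases j <;> simp [blockOf, omegaMatR] <;> ring
  have e00 : |realEntry hw x| ≤ c * (1 + |tr| + |nr|) := hxc.trans h1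
  have e01 : |realEntry hw (-(algebraMap k (Ad k) q.n) * y)| ≤ c * (1 + |tr| + |nr|) := by
    rw [map_mul, map_neg, realEntry_n, abs_mul, abs_neg]
    calc |nr| * |realEntry hw y| ≤ |nr| * c := mul_le_mul_of_nonneg_left hyc (abs_nonneg _)
      _ ≤ c * (1 + |tr| + |nr|) := by nlinarith [abs_nonneg tr, abs_nonneg nr]
  have e10 : |realEntry hw y| ≤ c * (1 + |tr| + |nr|) := hyc.trans h1
  have e11 : |realEntry hw (x + algebraMap k (Ad k) q.t * y)| ≤ c * (1 + |tr| + |nr|) := by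
    rw [map_add, map_mul, realEntry_t]
    calc |realEntry hw x + tr * realEntry hw y| ≤ |realEntry hw x| + |tr * realEntry hw y| := abs_add_le _ _
      _ = |realEntry hw x| + |tr| * |realEntry hw y| := by rw [abs_mul]
      _ ≤ c + |tr| * c := by gcongr
      _ ≤ c * (1 + |tr| + |nr|) := by nlinarith [abs_nonneg tr, abs_nonneg nr]
  rw [key]
  fin_cases i <;> fin_cases j
  · simpa using e00
  · simpa using e01
  · simpa using e10
  · simpa using e11

/-- The entries of a block-diagonal matrix with bounded blocks are bounded. -/
theorem abs_realEntry_blockDiag4R_le (A D : Matrix (Fin 2) (Fin 2) (Ad k)) (C : ℝ) (hC : 0 ≤ C)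
    (hA : ∀ i j, |realEntry hw (A i j)| ≤ C) (hD : ∀ i j, |realEntry hw (D i j)| ≤ C) (i j : Fin 4) :
    |realEntry hw (blockDiag4R A D i j)| ≤ C := by
  fin_cases i <;> fin_cases j
  · show |realEntry hw (A 0 0)| ≤ C
    exact hA 0 0
  · show |realEntry hw (A 0 1)| ≤ C
    exact hA 0 1
  · show |realEntry hw 0| ≤ C
    simp [hC]
  · show |realEntry hw 0| ≤ C
    simp [hC]
  · show |realEntry hw (A 1 0)| ≤ C
    exact hA 1 0
  · show |realEntry hw (A 1 1)| ≤ C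
    exact hA 1 1
  · show |realEntry hw 0| ≤ C
    simp [hC]
  · show |realEntry hw 0| ≤ C
    simp [hC]
  · show |realEntry hw 0| ≤ C
    simp [hC]
  · show |realEntry hw 0| ≤ C
    simp [hC]
  · show |realEntry hw (D 0 0)| ≤ C
    exact hD 0 0
  · show |realEntry hw (D 0 1)| ≤ C
    exact hD 0 1
  · show |realEntry hw 0| ≤ C
    simp [hC]
  · show |realEntry hw 0| ≤ C
    simp [hC]
  · show |realEntry hw (D 1 0)| ≤ C
    exact hD 1 0
  · show |realEntry hw (D 1 1)| ≤ C
    exact hD 1 1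

end RealPlace

section Closed

variable {k : Type} [Field k] [NumberField k] (W : PlaneData k)

/-- `finiteComponent v g = 1` is an entrywise condition. -/
theorem finiteComponent_eq_one_iff (v : HeightOneSpectrum (𝓞 k)) (g : GA W) :
    GA.finiteComponent W v g = 1 ↔
      ∀ i j, adComponentFin k v (GA.mat W g i j) = (1 : Matrix (Fin 4) (Fin 4) (v.adicCompletion k)) i j := by
  constructor
  · intro h i j
    rw [← GA.finiteComponent_apply, h, Units.val_one]
  · intro h
    apply Units.ext
    apply Matrix.ext
    intro i j
    rw [Units.val_one, GA.finiteComponent_apply]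
    exact h i j

/-- `infiniteComponent w' g = 1` is an entrywise condition. -/
theorem infiniteComponent_eq_one_iff (w' : InfinitePlace k) (g : GA W) :
    GA.infiniteComponent W w' g = 1 ↔
      ∀ i j, adComponentInf k w' (GA.mat W g i j) = (1 : Matrix (Fin 4) (Fin 4) w'.Completion) i j := by
  constructor
  · intro h i j
    have : ((GA.infiniteComponent W w' g : GL (Fin 4) w'.Completion) : Matrix (Fin 4) (Fin 4) w'.Completion) i j =
        adComponentInf k w' (GA.mat W g i j) := rfl
    rw [← this, h, Units.val_one]
  · intro h
    apply Units.ext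
    apply Matrix.ext
    intro i j
    rw [Units.val_one]
    exact h i j

/-- The elements supported at `w` form a closed set. -/
theorem isClosed_atPlace (w : InfinitePlace k) : IsClosed (atPlace W w : Set (GA W)) := by
  have hmat : ∀ i j, Continuous fun g : GA W => GA.mat W g i j :=
    fun i j => (Units.continuous_val.comp continuous_subtype_val).matrix_elem i j
  have hfin : ∀ v : HeightOneSpectrum (𝓞 k), IsClosed {g : GA W | GA.finiteComponent W v g = 1} := by
    intro v
    have : {g : GA W | GA.finiteComponent W v g = 1} = ⋂ i, ⋂ j,
        {g : GA W | adComponentFin k v (GA.mat W g i j) = (1 : Matrix (Fin 4) (Fin 4) (v.adicCompletion k)) i j} := by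
      ext g
      simp only [Set.mem_setOf_eq, Set.mem_iInter]
      exact finiteComponent_eq_one_iff W v g
    rw [this]
    refine isClosed_iInter fun i => isClosed_iInter fun j => isClosed_eq ?_ continuous_const
    exact (RestrictedProduct.continuous_eval v).comp (continuous_snd.comp (hmat i j))
  have hinf : ∀ w' : InfinitePlace k, IsClosed {g : GA W | GA.infiniteComponent W w' g = 1} := by
    intro w'
    have : {g : GA W | GA.infiniteComponent W w' g = 1} = ⋂ i, ⋂ j,
        {g : GA W | adComponentInf k w' (GA.mat W g i j) = (1 : Matrix (Fin 4) (Fin 4) w'.Completion) i j} := by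
      ext g
      simp only [Set.mem_setOf_eq, Set.mem_iInter]
      exact infiniteComponent_eq_one_iff W w' g
    rw [this]
    refine isClosed_iInter fun i => isClosed_iInter fun j => isClosed_eq ?_ continuous_const
    exact (continuous_apply w').comp (continuous_fst.comp (hmat i j))
  have : (atPlace W w : Set (GA W)) = (⋂ v, {g : GA W | GA.finiteComponent W v g = 1}) ∩
      ⋂ w' : {w' : InfinitePlace k // w' ≠ w}, {g : GA W | GA.infiniteComponent W w' g = 1} := by
    ext g
    simp only [SetLike.mem_coe, Set.mem_inter_iff, Set.mem_iInter, Set.mem_setOf_eq]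
    constructor
    · rintro ⟨h1, h2⟩
      exact ⟨h1, fun w' => h2 w' w'.2⟩
    · rintro ⟨h1, h2⟩
      exact ⟨h1, fun w' hw' => h2 ⟨w', hw'⟩⟩
  rw [this]
  exact (isClosed_iInter hfin).inter (isClosed_iInter fun w' => hinf w')

/-- The local torus `T(k_w)` is closed. -/
theorem isClosed_localTorusAt (w : InfinitePlace k) : IsClosed (localTorusAt W w : Set (GA W)) := by
  rw [localTorusAt, Subgroup.coe_inf]
  exact (isClosed_torusT W).inter (isClosed_atPlace W w)

/-- The local torus `T′(k_w)` is closed. -/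
theorem isClosed_localTorusAt' (w : InfinitePlace k) : IsClosed (localTorusAt' W w : Set (GA W)) := by
  rw [localTorusAt', Subgroup.coe_inf]
  exact (isClosed_torusT' W).inter (isClosed_atPlace W w)

end Closed

section Box

open scoped Classical

variable {k : Type} [Field k] [NumberField k]

/-- The compact set of adeles with prescribed components away from `w` and `w`-component in the real interval
`[−C, C]`: the image of the compact interval preimage under `z ↦ (update cInf w z, cFin)`. -/
def entryBoxAt {w : InfinitePlace k} (hw : w.IsReal) (C : ℝ) (cInf : InfiniteAdeleRing k)
    (cFin : FiniteAdeleRing (𝓞 k) k) : Set (Ad k) :=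
  (fun z : w.Completion =>
      ((Function.update (cInf : (v : InfinitePlace k) → v.Completion) w z, cFin) : Ad k)) ''
    ((InfinitePlace.Completion.extensionEmbeddingOfIsReal hw) ⁻¹' Set.Icc (-C) C)

/-- The entry box is compact. -/
theorem isCompact_entryBoxAt {w : InfinitePlace k} (hw : w.IsReal) (C : ℝ) (cInf : InfiniteAdeleRing k)
    (cFin : FiniteAdeleRing (𝓞 k) k) : IsCompact (entryBoxAt hw C cInf cFin) := by
  refine IsCompact.image ?_ ?_
  · exact (InfinitePlace.Completion.isometry_extensionEmbeddingOfIsReal hw).isClosedEmbedding.isCompact_preimage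
      isCompact_Icc
  · exact (continuous_const.update w continuous_id).prodMk continuous_const

/-- Membership in the entry box from the three conditions. -/
theorem mem_entryBoxAt {w : InfinitePlace k} (hw : w.IsReal) (C : ℝ) (cInf : InfiniteAdeleRing k)
    (cFin : FiniteAdeleRing (𝓞 k) k) {a : Ad k} (hbound : |realEntry hw a| ≤ C)
    (hinf : ∀ w' : InfinitePlace k, w' ≠ w → infPart k a w' = cInf w') (hfin : finPart k a = cFin) :
    a ∈ entryBoxAt hw C cInf cFin := by
  refine ⟨infPart k a w, ?_, ?_⟩
  · show InfinitePlace.Completion.extensionEmbeddingOfIsReal hw (infPart k a w) ∈ Set.Icc (-C) C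
    rw [← realEntry_eq hw a]
    exact abs_le.1 hbound
  · apply Prod.ext
    · funext w'
      show Function.update (cInf : (v : InfinitePlace k) → v.Completion) w (infPart k a w) w' = a.1 w'
      by_cases h : w' = w
      · subst h
        rw [Function.update_self]
        rfl
      · rw [Function.update_of_ne h]
        exact (hinf w' h).symm
    · exact hfin.symm

/-- The compact box of adelic matrices: identity components away from `w` and at the finite places, `w`-entries in
`[−C, C]`. -/
def torusBox {w : InfinitePlace k} (hw : w.IsReal) (C : ℝ) : Set (M4 k) :=
  Set.pi Set.univ fun i => Set.pi Set.univ fun j =>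
    entryBoxAt hw C (infPart k ((1 : M4 k) i j)) (finPart k ((1 : M4 k) i j))

/-- The box is compact (Tychonoff). -/
theorem isCompact_torusBox {w : InfinitePlace k} (hw : w.IsReal) (C : ℝ) : IsCompact (torusBox hw C) :=
  isCompact_univ_pi fun _ => isCompact_univ_pi fun _ => isCompact_entryBoxAt hw C _ _

variable (q : QuadData k) (a b ε : k)

/-- The infinite components of an element supported at `w` are the identity entries away from `w`. -/
theorem infPart_entry_of_isAtPlace {W : PlaneData k} {w : InfinitePlace k} {g : GA W} (hg : IsAtPlace W w g)
    (i j : Fin 4) (w' : InfinitePlace k) (hw' : w' ≠ w) : infPart k (GA.mat W g i j) w' = infPart k ((1 : M4 k) i j) w' := by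
  have h := (infiniteComponent_eq_one_iff W w' g).1 (hg.2 w' hw') i j
  show adComponentInf k w' (GA.mat W g i j) = adComponentInf k w' ((1 : M4 k) i j)
  rw [h]
  have : ((1 : M4 k).map (adComponentInf k w')) i j = (1 : Matrix (Fin 4) (Fin 4) w'.Completion) i j := by
    rw [Matrix.map_one _ (map_zero _) (map_one _)]
  rw [← this, Matrix.map_apply]

/-- The finite part of an element supported at an infinite place is the identity. -/
theorem finPart_entry_of_isAtPlace {W : PlaneData k} {w : InfinitePlace k} {g : GA W} (hg : IsAtPlace W w g)
    (i j : Fin 4) : finPart k (GA.mat W g i j) = finPart k ((1 : M4 k) i j) := by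
  apply RestrictedProduct.ext _ _
  intro v
  have h := (finiteComponent_eq_one_iff W v g).1 (hg.1 v) i j
  show adComponentFin k v (GA.mat W g i j) = adComponentFin k v ((1 : M4 k) i j)
  rw [h]
  have : ((1 : M4 k).map (adComponentFin k v)) i j = (1 : Matrix (Fin 4) (Fin 4) (v.adicCompletion k)) i j := by
    rw [Matrix.map_one _ (map_zero _) (map_one _)]
  rw [← this, Matrix.map_apply]

/-- **The matrix of a local torus element lies in the box** (`C := blockBound q w`). -/
theorem mem_torusBox_of_mem_localTorusAt (ha : a ≠ 0) (hb : b ≠ 0) (hε : ε ≠ 0) {w : InfinitePlace k}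
    (hw : w.IsReal) (hcm : IsCMAt q w) {κ : GA (PlaneData.ofLinesRow q a b ε)}
    (hκ : κ ∈ localTorusAt (PlaneData.ofLinesRow q a b ε) w) :
    GA.mat (PlaneData.ofLinesRow q a b ε) κ ∈ torusBox hw (blockBound q w) := by
  obtain ⟨hT, hat⟩ := hκ
  obtain ⟨x₀, y₀, x₁, y₁, hmat, hN₀, hN₁⟩ := exists_blockOf_of_mem_torusT q a b ε ha hb hε κ hT
  have hbound : ∀ i j, |realEntry hw (GA.mat (PlaneData.ofLinesRow q a b ε) κ i j)| ≤ blockBound q w := by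
    intro i j
    rw [hmat]
    exact abs_realEntry_blockDiag4R_le hw _ _ _ (blockBound_nonneg q w)
      (abs_realEntry_blockOf_le q hw hcm x₀ y₀ hN₀) (abs_realEntry_blockOf_le q hw hcm x₁ y₁ hN₁) i j
  refine Set.mem_univ_pi.2 fun i => Set.mem_univ_pi.2 fun j => mem_entryBoxAt hw _ _ _ (hbound i j) ?_ ?_
  · exact fun w' hw' => infPart_entry_of_isAtPlace hat i j w' hw'
  · exact finPart_entry_of_isAtPlace hat i j

/-- **THE LOCAL TORUS OF A ROW PLANE AT A REAL CM PLACE IS COMPACT**: closed, and inside the preimage of the compact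
`torusBox ×ˢ op '' torusBox` under the closed embedding `g ↦ (g, g⁻¹)` (both `κ` and `κ⁻¹` lie in the local torus). -/
theorem isCompact_localTorusAt_ofLinesRow (ha : a ≠ 0) (hb : b ≠ 0) (hε : ε ≠ 0) {w : InfinitePlace k}
    (hw : w.IsReal) (hcm : IsCMAt q w) :
    IsCompact (localTorusAt (PlaneData.ofLinesRow q a b ε) w : Set (GA (PlaneData.ofLinesRow q a b ε))) := by
  set W := PlaneData.ofLinesRow q a b ε with hW
  set C := blockBound q w with hC
  have hP : IsCompact ((torusBox hw C) ×ˢ (MulOpposite.op '' torusBox hw C)) :=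
    (isCompact_torusBox hw C).prod ((isCompact_torusBox hw C).image MulOpposite.continuous_op)
  have hpre : IsCompact ((fun g : GA W => Units.embedProduct (M4 k) (g : GL4 k)) ⁻¹'
      ((torusBox hw C) ×ˢ (MulOpposite.op '' torusBox hw C))) :=
    (isClosedEmbedding_embed W).isCompact_preimage hP
  refine hpre.of_isClosed_subset (isClosed_localTorusAt W w) ?_
  intro κ hκ
  show Units.embedProduct (M4 k) (κ : GL4 k) ∈ (torusBox hw C) ×ˢ (MulOpposite.op '' torusBox hw C)
  rw [Units.embedProduct_apply]
  refine ⟨mem_torusBox_of_mem_localTorusAt q a b ε ha hb hε hw hcm hκ, ?_⟩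
  refine ⟨GA.mat W κ⁻¹, mem_torusBox_of_mem_localTorusAt q a b ε ha hb hε hw hcm ((localTorusAt W w).inv_mem hκ), ?_⟩
  rfl

/-- The typeclass form: `localTorusAt (ofLinesRow q a b ε) w` is a compact space at a real CM place. -/
theorem compactSpace_localTorusAt_ofLinesRow (ha : a ≠ 0) (hb : b ≠ 0) (hε : ε ≠ 0) {w : InfinitePlace k}
    (hw : w.IsReal) (hcm : IsCMAt q w) : CompactSpace (localTorusAt (PlaneData.ofLinesRow q a b ε) w) :=
  isCompact_iff_compactSpace.1 (isCompact_localTorusAt_ofLinesRow q a b ε ha hb hε hw hcm)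

end Box

end Summit.Ventures.HodgeRepro.Tier4.Common

end
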